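import Literature.NumberTheory.Transcendental.ExpPointsLogTypeRegular
import Literature.NumberTheory.Transcendental.AxSchanuelTwoGerms
import HarnessLib

/-!
# The cusp germ of a curve of exponential points: algebraic tail forces a classical class

Setting: `W ⊆ ℂ² × ℂ²` with `zariskiDim ℂ W < 2` and a normalised cusp ray
`𝔠₁(s) = ((2πi s⁻ᵉ + ℓu(s), 2πi (A(s⁻¹) + g(s)) + ℓv(s)), (e^{ℓu(s)}, e^{ℓv(s)})) ∈ W` (`0 < |s| < ρ`)
carrying infinitely many independent exponential points at real parameters `s = ρ' → 0⁺`.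
If the tail `g` is ALGEBRAIC over `ℂ(s)` (`P(s, g(s)) = 0` near `0`, `P ≠ 0`), then
(`classical_class_of_algebraic_tail`) either some degenerate section `a x₀ + b x₁ = c`,
`(a, b) ∈ ℤ² ∖ 0`, or some fibre `eˣ = ω` carries infinitely many independent exponential points.
Proof (Ax 1971 for one derivation, `n = 2`): in `ℂ⸨X⸩` the Laurent expansions of all branch
coordinates are algebraic over `ℂ[x̂₀]` (`ExpPointsBranchLaurent`), and `ĝ, Â` over `ℂ[ŝ]`; so
`ℓ̂u, ℓ̂v, ŷ₀, ŷ₁` are algebraic over `ℂ[ŝ, x̂₀]` and Ax (`AxSchanuelTwoGerms`) gives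
`a ℓu + b ℓv ≡ c`. If `ŝ` is algebraic over `ℂ[x̂₀]` both `ℓu, ℓv` are forced constant (a
non-constant analytic `Λ` with `e^Λ` algebraic over `ℂ(Λ)` is impossible), whence `y` is constant
on the branch: a fibre. Otherwise `G = a ŝ⁻ᵉ + b(Â + ĝ) ∈ cl{ŝ} ∩ cl{x̂₀}` must be a constant by
the exchange property, so `L = a x₀ + b x₁` is constant on the branch: a degenerate section.
PROVED, no definition. [cite: Ax1971, Thm. 3]
-/

noncomputable section

open Complex Filter Topology Set Metric PowerSeries HahnSeries LaurentSeries MvPolynomial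

namespace Literature.NumberTheory.Transcendental

open Literature.Analysis.Complex.LaurentGerm
open Literature.Analysis.Complex.MeromorphicGerm (analyticAt_pow_succ_mul_inv_pow)
open Literature.FieldTheory.TranscendenceDegree
open Literature.Analysis.Complex.FormalRoot (eventuallyEq_of_taylor_eq taylor_polynomial)
open Literature.RingTheory.PowerSeries (algebraMap_laurentSeries_apply)
open Literature.NumberTheory.Transcendental.AxTwoGerms (exists_int_rel_of_isAlgebraic_taylor taylor_const)

/-- The Taylor series of `f : ℂ → ℂ` at `0`, as a formal power series (local notation). -/
local notation3 "𝓣[" f "]" =>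
  (PowerSeries.mk fun n => ((Nat.factorial n : ℂ)⁻¹ * iteratedDeriv n f 0) : PowerSeries ℂ)

/-- The Laurent expansion at `0` of a germ `f` with `zⁿ f(z)` analytic at `0` (local notation). -/
local notation3 "𝓛[" n ", " f "]" =>
  (HahnSeries.single (-((n : ℕ) : ℤ)) (1 : ℂ) *
    HahnSeries.ofPowerSeries ℤ ℂ 𝓣[fun z : ℂ => z ^ (n : ℕ) * (f : ℂ → ℂ) z] : LaurentSeries ℂ)

/-- The normalised cusp form (local notation). -/
local notation3 "𝔠₁[" e ", " A ", " g ", " ℓu ", " ℓv ", " s "]" =>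
  (Sum.elim ![2 * (Real.pi : ℂ) * I * (s : ℂ)⁻¹ ^ (e : ℕ) + (ℓu : ℂ → ℂ) s,
      2 * (Real.pi : ℂ) * I * (Polynomial.eval s⁻¹ (A : Polynomial ℂ) + (g : ℂ → ℂ) s) + (ℓv : ℂ → ℂ) s]
    ![Complex.exp ((ℓu : ℂ → ℂ) s), Complex.exp ((ℓv : ℂ → ℂ) s)] : Fin 2 ⊕ Fin 2 → ℂ)

/-! ### Tools -/

/-- Raising the exponent. [folklore] -/
theorem analyticAt_pow_of_le {f : ℂ → ℂ} {n K : ℕ} (hf : AnalyticAt ℂ (fun t : ℂ => t ^ n * f t) 0)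
    (hle : n ≤ K) : AnalyticAt ℂ (fun t : ℂ => t ^ K * f t) 0 := by
  obtain ⟨k, rfl⟩ := Nat.exists_eq_add_of_le hle
  exact analyticAt_pow_add hf k

/-- `𝓛` at a raised exponent. [folklore] -/
theorem laurent_eq_of_le {f : ℂ → ℂ} {n K : ℕ} (hf : AnalyticAt ℂ (fun t : ℂ => t ^ n * f t) 0)
    (hle : n ≤ K) : 𝓛[K, f] = 𝓛[n, f] :=
  laurent_eq_of_analyticAt (analyticAt_pow_of_le hf hle) hf

/-- `s^{d+1} · A(s⁻¹)` is analytic at `0` (`d = deg A`), being a polynomial in `s`. [folklore] -/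
theorem analyticAt_pow_mul_eval_inv (A : Polynomial ℂ) :
    AnalyticAt ℂ (fun s : ℂ => s ^ (A.natDegree + 1) * A.eval s⁻¹) 0 := by
  have hfun : (fun s : ℂ => s ^ (A.natDegree + 1) * A.eval s⁻¹) =
      fun s => ∑ k ∈ Finset.range (A.natDegree + 1), A.coeff k * s ^ (A.natDegree + 1 - k) := by
    funext s
    rw [Polynomial.eval_eq_sum_range, Finset.mul_sum]
    refine Finset.sum_congr rfl fun k hk => ?_
    have hk' : k ≤ A.natDegree := Nat.lt_succ_iff.1 (Finset.mem_range.1 hk)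
    by_cases hs : s = 0
    · subst hs
      have h1 : A.natDegree + 1 - k ≠ 0 := by omega
      simp [zero_pow h1]
    · calc s ^ (A.natDegree + 1) * (A.coeff k * s⁻¹ ^ k)
          = A.coeff k * (s ^ (A.natDegree + 1) * (s ^ k)⁻¹) := by rw [inv_pow]; ring
        _ = A.coeff k * s ^ (A.natDegree + 1 - k) := by
          rw [← pow_sub₀ s hs (by omega)]
  rw [hfun]
  exact Finset.analyticAt_fun_sum _ fun k _ => analyticAt_const.mul (analyticAt_id.pow _)

/-- **`A(s⁻¹)` is algebraic over `ℂ[ŝ]`**: the relation `s^d · A(s⁻¹) = Σ a_k s^{d-k}`. [folklore] -/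
theorem isAlgebraic_laurent_eval_inv (A : Polynomial ℂ) :
    IsAlgebraic (Algebra.adjoin ℂ ({𝓛[0, fun z : ℂ => z]} : Set (LaurentSeries ℂ)))
      𝓛[A.natDegree + 1, fun s : ℂ => A.eval s⁻¹] := by
  classical
  set d := A.natDegree with hd
  -- the relation polynomial `Q = X₀^d X₁ - Σ a_k X₀^{d-k}`
  set Q : MvPolynomial (Fin 2) ℂ := MvPolynomial.X 0 ^ d * MvPolynomial.X 1 -
    ∑ k ∈ Finset.range (d + 1), MvPolynomial.C (A.coeff k) * MvPolynomial.X 0 ^ (d - k) with hQ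
  have hQ0 : Q ≠ 0 := by
    intro h0
    have := congrArg (MvPolynomial.eval ![(1 : ℂ), (∑ k ∈ Finset.range (d + 1), A.coeff k) + 1]) h0
    simp only [hQ, map_sub, map_mul, map_pow, MvPolynomial.eval_X, map_sum, MvPolynomial.eval_C,
      Matrix.cons_val_zero, Matrix.cons_val_one, one_pow, one_mul, mul_one, map_zero] at this
    simp at this
  have hrel : ∀ᶠ s in 𝓝[≠] (0 : ℂ), MvPolynomial.eval ![s, A.eval s⁻¹] Q = 0 := by
    filter_upwards [self_mem_nhdsWithin] with s hs0
    have hs : s ≠ 0 := by rintro rfl; exact hs0 (Set.mem_singleton 0)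
    simp only [hQ, map_sub, map_mul, map_pow, MvPolynomial.eval_X, map_sum, MvPolynomial.eval_C,
      Matrix.cons_val_zero, Matrix.cons_val_one]
    rw [Polynomial.eval_eq_sum_range, Finset.mul_sum, sub_eq_zero]
    refine Finset.sum_congr rfl fun k hk => ?_
    have hk' : k ≤ d := Nat.lt_succ_iff.1 (Finset.mem_range.1 hk)
    calc s ^ d * (A.coeff k * s⁻¹ ^ k) = A.coeff k * (s ^ d * (s ^ k)⁻¹) := by rw [inv_pow]; ring
      _ = A.coeff k * s ^ (d - k) := by rw [← pow_sub₀ s hs hk']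
  have h0 : AnalyticAt ℂ (fun t : ℂ => t ^ 0 * t) 0 := by
    simp only [pow_zero, one_mul]; exact analyticAt_id
  have hs : Transcendental ℂ 𝓛[0, fun z : ℂ => z] := by
    rw [laurent_id]
    exact transcendental_of_coeff_ne_zero (n := 1) one_ne_zero (by rw [HahnSeries.coeff_single_same]; exact one_ne_zero)
  exact isAlgebraic_adjoin_singleton_of_aeval_eq_zero hQ0
    (aeval_laurent_eq_zero h0 (analyticAt_pow_mul_eval_inv A) Q hrel) hs

/-- **`e^{Λ}` algebraic over `ℂ(Λ)` forces `Λ` constant**, Laurent form: if `Λ̂` and `(e^{Λ})^` are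
both algebraic over `ℂ[a]` for one `a ∈ ℂ⸨X⸩`, then `Λ` is constant near `0`. [folklore] -/
theorem eventually_const_of_isAlgebraic_exp {Λ : ℂ → ℂ} (hΛ : AnalyticAt ℂ Λ 0) {a : LaurentSeries ℂ}
    (h₁ : IsAlgebraic (Algebra.adjoin ℂ ({a} : Set (LaurentSeries ℂ))) 𝓛[0, Λ])
    (h₂ : IsAlgebraic (Algebra.adjoin ℂ ({a} : Set (LaurentSeries ℂ))) 𝓛[0, fun t => exp (Λ t)]) :
    ∀ᶠ t in 𝓝 (0 : ℂ), Λ t = Λ 0 := by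
  obtain ⟨R, hR0, hRel⟩ := exists_relation_of_isAlgebraic_pair h₁ h₂
  have h1 : AnalyticAt ℂ (fun t : ℂ => t ^ 0 * Λ t) 0 := by simpa using hΛ
  have hEan : AnalyticAt ℂ (fun t : ℂ => t ^ 0 * exp (Λ t)) 0 := by
    have hexp : AnalyticAt ℂ (fun t => exp (Λ t)) 0 := analyticAt_cexp.comp hΛ
    simpa using hexp
  have hev := (laurent_eval h1 hEan R (N := 0) (by simp)).1
  beta_reduce at hev
  rw [hRel] at hev
  have han : AnalyticAt ℂ (fun t : ℂ => t ^ 0 * MvPolynomial.eval ![Λ t, exp (Λ t)] R) 0 :=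
    (laurent_eval h1 hEan R (N := 0) (by simp)).2
  have hzero : ∀ᶠ t in 𝓝[≠] (0 : ℂ), MvPolynomial.eval ![Λ t, exp (Λ t)] R = 0 := by
    rw [← laurent_eq_zero_iff han, hev]
  exact eventually_const_of_relation_exp hΛ hR0 hzero

/-! ### The dichotomy -/

/-- **Algebraic tail forces a classical class.** See the module docstring. [cite: Ax1971, Thm. 3] -/
theorem classical_class_of_algebraic_tail {W : Set (Fin 2 ⊕ Fin 2 → ℂ)} (hdim : zariskiDim ℂ W < 2)
    {e : ℕ} (he : 0 < e) {A : Polynomial ℂ} {g ℓu ℓv : ℂ → ℂ} {ρ : ℝ} (hρ : 0 < ρ)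
    (hg : AnalyticAt ℂ g 0) (hℓu : AnalyticAt ℂ ℓu 0) (hℓv : AnalyticAt ℂ ℓv 0)
    (hin : ∀ s : ℂ, 0 < ‖s‖ → ‖s‖ < ρ → 𝔠₁[e, A, g, ℓu, ℓv, s] ∈ W)
    (hhit : ∀ δ : ℝ, 0 < δ → Set.Infinite {x | x ∈ indepExpPoints W ∧ ∃ ρ' : ℝ, 0 < ρ' ∧ ρ' < δ ∧
      Sum.elim x (Complex.exp ∘ x) = 𝔠₁[e, A, g, ℓu, ℓv, (ρ' : ℂ)]})
    (halg : ∃ P : MvPolynomial (Fin 2) ℂ, P ≠ 0 ∧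
      ∀ᶠ z in 𝓝 (0 : ℂ), MvPolynomial.eval ![z, g z] P = 0) :
    (∃ a b : ℤ, (a ≠ 0 ∨ b ≠ 0) ∧ ∃ c : ℂ,
        Set.Infinite {x : Fin 2 → ℂ | x ∈ indepExpPoints W ∧ (a : ℂ) * x 0 + (b : ℂ) * x 1 = c}) ∨
      (∃ ω : Fin 2 → ℂ,
        Set.Infinite {x : Fin 2 → ℂ | x ∈ indepExpPoints W ∧ Complex.exp ∘ x = ω}) := by
  classical
  -- ### the branch coordinates and their pole orders
  set c₀ : ℂ := 2 * Real.pi * I with hc₀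
  set X₀ : ℂ → ℂ := fun s => c₀ * s⁻¹ ^ e + ℓu s with hX₀
  set X₁ : ℂ → ℂ := fun s => c₀ * (A.eval s⁻¹ + g s) + ℓv s with hX₁
  set d : ℕ := A.natDegree with hd
  set K : ℕ := (e + 1) + (d + 1) with hK
  have hid : AnalyticAt ℂ (fun t : ℂ => t ^ 0 * t) 0 := by
    simp only [pow_zero, one_mul]; exact analyticAt_id
  have hinv : AnalyticAt ℂ (fun t : ℂ => t ^ (e + 1) * t⁻¹ ^ e) 0 := by
    simpa only [inv_pow] using analyticAt_pow_succ_mul_inv_pow e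
  have hinvL : 𝓛[e + 1, fun t : ℂ => t⁻¹ ^ e] = HahnSeries.single (-(e : ℤ)) (1 : ℂ) := by
    have := (laurent_inv_pow e).1
    simpa only [inv_pow] using this
  have hAi : AnalyticAt ℂ (fun t : ℂ => t ^ (d + 1) * A.eval t⁻¹) 0 := analyticAt_pow_mul_eval_inv A
  have h0 : ∀ {f : ℂ → ℂ}, AnalyticAt ℂ f 0 → AnalyticAt ℂ (fun t : ℂ => t ^ 0 * f t) 0 :=
    fun hf => by simpa using hf
  have hY₀ : AnalyticAt ℂ (fun t => exp (ℓu t)) 0 := analyticAt_cexp.comp hℓu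
  have hY₁ : AnalyticAt ℂ (fun t => exp (ℓv t)) 0 := analyticAt_cexp.comp hℓv
  have hP₀ : AnalyticAt ℂ (fun t : ℂ => t ^ K * (c₀ * t⁻¹ ^ e)) 0 :=
    analyticAt_pow_of_le (analyticAt_const_mul hinv c₀) (Nat.le_add_right _ _)
  have hP₁ : AnalyticAt ℂ (fun t : ℂ => t ^ K * (c₀ * (A.eval t⁻¹ + g t))) 0 :=
    analyticAt_pow_of_le (analyticAt_const_mul (analyticAt_add hAi
      (analyticAt_pow_of_le (h0 hg) (Nat.zero_le _))) c₀) (Nat.le_add_left _ _)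
  have hX₀K : AnalyticAt ℂ (fun t : ℂ => t ^ K * X₀ t) 0 :=
    analyticAt_add hP₀ (analyticAt_pow_of_le (h0 hℓu) (Nat.zero_le _))
  have hX₁K : AnalyticAt ℂ (fun t : ℂ => t ^ K * X₁ t) 0 :=
    analyticAt_add hP₁ (analyticAt_pow_of_le (h0 hℓv) (Nat.zero_le _))
  -- ### Laurent expansions
  have hx₀ : 𝓛[K, X₀] = HahnSeries.C c₀ * HahnSeries.single (-(e : ℤ)) (1 : ℂ) + 𝓛[0, ℓu] := by
    have h1 := laurent_add hP₀ (analyticAt_pow_of_le (h0 hℓu) (Nat.zero_le _))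
    beta_reduce at h1
    simp only [hX₀]
    rw [h1, laurent_const_mul, laurent_eq_of_le hinv (Nat.le_add_right _ _), hinvL,
      laurent_eq_of_le (h0 hℓu) (Nat.zero_le _)]
  have hx₁ : 𝓛[K, X₁] = HahnSeries.C c₀ * (𝓛[d + 1, fun t : ℂ => A.eval t⁻¹] + 𝓛[0, g]) + 𝓛[0, ℓv] := by
    have h1 := laurent_add hP₁ (analyticAt_pow_of_le (h0 hℓv) (Nat.zero_le _))
    have h2 := laurent_add (analyticAt_pow_of_le hAi (Nat.le_add_left _ (e + 1)))
      (analyticAt_pow_of_le (h0 hg) (Nat.zero_le K))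
    beta_reduce at h1 h2
    simp only [hX₁]
    rw [h1, laurent_const_mul, h2, laurent_eq_of_le hAi (Nat.le_add_left _ _),
      laurent_eq_of_le (h0 hg) (Nat.zero_le _), laurent_eq_of_le (h0 hℓv) (Nat.zero_le _)]
  -- ### transcendence of `x̂₀` and `ŝ`
  have hc₀0 : c₀ ≠ 0 := by simp [hc₀, Real.pi_ne_zero, I_ne_zero]
  have htr₀ : Transcendental ℂ 𝓛[K, X₀] := by
    rw [hx₀]
    refine transcendental_of_coeff_ne_zero (n := -(e : ℤ)) (by omega) ?_
    rw [HahnSeries.coeff_add', Pi.add_apply, HahnSeries.C_mul_eq_smul, HahnSeries.coeff_smul,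
      HahnSeries.coeff_single_same, laurent_of_analyticAt, PowerSeries.coeff_coe,
      if_pos (by omega), smul_eq_mul, mul_one, add_zero]
    exact hc₀0
  have htrs : Transcendental ℂ 𝓛[0, fun z : ℂ => z] := by
    rw [laurent_id]
    exact transcendental_of_coeff_ne_zero (n := 1) one_ne_zero
      (by rw [HahnSeries.coeff_single_same]; exact one_ne_zero)
  -- ### the branch in `W` and its Laurent coordinates
  have hWev : ∀ᶠ t in 𝓝[≠] (0 : ℂ),
      (Sum.elim ![X₀ t, X₁ t] ![exp (ℓu t), exp (ℓv t)] : Fin 2 ⊕ Fin 2 → ℂ) ∈ W := by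
    have hball : ∀ᶠ t in 𝓝[≠] (0 : ℂ), ‖t‖ < ρ :=
      eventually_nhdsWithin_of_eventually_nhds (eventually_norm_sub_lt 0 hρ |>.mono fun t ht => by simpa using ht)
    filter_upwards [hball, self_mem_nhdsWithin] with t ht ht0
    have htne : t ≠ 0 := by rintro rfl; exact ht0 (Set.mem_singleton 0)
    exact hin t (norm_pos_iff.2 htne) ht
  obtain ⟨ha₁, ha₂, ha₃⟩ := isAlgebraic_coords_of_branch hdim hX₀K hX₁K (h0 hY₀) (h0 hY₁) hWev htr₀
  -- ### `Â, ĝ ∈ cl{ŝ}`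
  have hAalg := isAlgebraic_laurent_eval_inv A
  have hgalg : IsAlgebraic (Algebra.adjoin ℂ ({𝓛[0, fun z : ℂ => z]} : Set (LaurentSeries ℂ))) 𝓛[0, g] := by
    obtain ⟨P, hP0, hP⟩ := halg
    exact isAlgebraic_adjoin_singleton_of_aeval_eq_zero hP0
      (aeval_laurent_eq_zero hid (h0 hg) P (eventually_nhdsWithin_of_eventually_nhds hP)) htrs
  -- ### everything is algebraic over `ℂ[ŝ, x̂₀]`
  set sF : Finset (LaurentSeries ℂ) := {𝓛[0, fun z : ℂ => z], 𝓛[K, X₀]} with hsF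
  have hsFc : (sF : Set (LaurentSeries ℂ)) = {𝓛[0, fun z : ℂ => z], 𝓛[K, X₀]} := by
    rw [hsF, Finset.coe_insert, Finset.coe_singleton]
  have hcard : sF.card ≤ 2 := by rw [hsF]; exact Finset.card_le_two
  have hmemS : IsAlgebraic (Algebra.adjoin ℂ (sF : Set (LaurentSeries ℂ))) 𝓛[0, fun z : ℂ => z] :=
    isAlgebraic_adjoin_of_mem (by rw [hsFc]; exact Set.mem_insert _ _)
  have hmemX : IsAlgebraic (Algebra.adjoin ℂ (sF : Set (LaurentSeries ℂ))) 𝓛[K, X₀] :=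
    isAlgebraic_adjoin_of_mem (by rw [hsFc]; exact Set.mem_insert_of_mem _ rfl)
  have fromX : ∀ {b : LaurentSeries ℂ}, IsAlgebraic (Algebra.adjoin ℂ ({𝓛[K, X₀]} : Set (LaurentSeries ℂ))) b →
      IsAlgebraic (Algebra.adjoin ℂ (sF : Set (LaurentSeries ℂ))) b :=
    fun hb => isAlgebraic_adjoin_of_isAlgebraic_singleton hmemX hb
  have fromS : ∀ {b : LaurentSeries ℂ}, IsAlgebraic (Algebra.adjoin ℂ ({𝓛[0, fun z : ℂ => z]} : Set (LaurentSeries ℂ))) b →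
      IsAlgebraic (Algebra.adjoin ℂ (sF : Set (LaurentSeries ℂ))) b :=
    fun hb => isAlgebraic_adjoin_of_isAlgebraic_singleton hmemS hb
  have hC : ∀ (S : Subalgebra ℂ (LaurentSeries ℂ)) (c : ℂ), IsAlgebraic S (HahnSeries.C c : LaurentSeries ℂ) :=
    fun S c => by
      rw [← algebraMap_laurentSeries_apply]
      exact isAlgebraic_algebraMap (⟨algebraMap ℂ (LaurentSeries ℂ) c, Subalgebra.algebraMap_mem _ c⟩ : S)
  -- `single (-e) 1 = ŝ⁻ᵉ`
  have hsinge : (HahnSeries.single (-(e : ℤ)) (1 : ℂ) : LaurentSeries ℂ) = (𝓛[0, fun z : ℂ => z] ^ e)⁻¹ := by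
    rw [laurent_id, ← RatFunc.single_one_eq_pow, HahnSeries.inv_single, inv_one]
  have hsingalg : ∀ (S : Subalgebra ℂ (LaurentSeries ℂ)), IsAlgebraic S 𝓛[0, fun z : ℂ => z] →
      IsAlgebraic S (HahnSeries.single (-(e : ℤ)) (1 : ℂ) : LaurentSeries ℂ) := fun S hS => by
    rw [hsinge]; exact (hS.pow e).inv
  have hℓu' : 𝓛[0, ℓu] = 𝓛[K, X₀] - HahnSeries.C c₀ * HahnSeries.single (-(e : ℤ)) (1 : ℂ) := by
    rw [hx₀]; ring
  have hℓv' : 𝓛[0, ℓv] = 𝓛[K, X₁] - HahnSeries.C c₀ * (𝓛[d + 1, fun t : ℂ => A.eval t⁻¹] + 𝓛[0, g]) := by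
    rw [hx₁]; ring
  have aℓu : IsAlgebraic (Algebra.adjoin ℂ (sF : Set (LaurentSeries ℂ))) 𝓛[0, ℓu] := by
    rw [hℓu']; exact hmemX.sub ((hC _ _).mul (hsingalg _ hmemS))
  have aℓv : IsAlgebraic (Algebra.adjoin ℂ (sF : Set (LaurentSeries ℂ))) 𝓛[0, ℓv] := by
    rw [hℓv']; exact (fromX ha₁).sub ((hC _ _).mul ((fromS hAalg).add (fromS hgalg)))
  -- ### Ax–Schanuel for two germs
  obtain ⟨a, b, hab, c, hc⟩ := exists_int_rel_of_isAlgebraic_taylor hℓu hℓv sF hcard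
    (by rw [← laurent_of_analyticAt]; exact aℓu) (by rw [← laurent_of_analyticAt]; exact aℓv)
    (by rw [← laurent_of_analyticAt]; exact fromX ha₂) (by rw [← laurent_of_analyticAt]; exact fromX ha₃)
  -- ### Case 1: `ŝ ∈ cl{x̂₀}`: both `ℓu, ℓv` constant, a fibre carries the hits
  by_cases hS : IsAlgebraic (Algebra.adjoin ℂ ({𝓛[K, X₀]} : Set (LaurentSeries ℂ))) 𝓛[0, fun z : ℂ => z]
  · have toX : ∀ {b : LaurentSeries ℂ},
        IsAlgebraic (Algebra.adjoin ℂ ({𝓛[0, fun z : ℂ => z]} : Set (LaurentSeries ℂ))) b →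
        IsAlgebraic (Algebra.adjoin ℂ ({𝓛[K, X₀]} : Set (LaurentSeries ℂ))) b :=
      fun hb => isAlgebraic_adjoin_of_isAlgebraic_singleton hS hb
    have hX₀mem : IsAlgebraic (Algebra.adjoin ℂ ({𝓛[K, X₀]} : Set (LaurentSeries ℂ))) 𝓛[K, X₀] :=
      isAlgebraic_adjoin_of_mem (Set.mem_singleton _)
    have bℓu : IsAlgebraic (Algebra.adjoin ℂ ({𝓛[K, X₀]} : Set (LaurentSeries ℂ))) 𝓛[0, ℓu] := by
      rw [hℓu']; exact hX₀mem.sub ((hC _ _).mul (hsingalg _ hS))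
    have bℓv : IsAlgebraic (Algebra.adjoin ℂ ({𝓛[K, X₀]} : Set (LaurentSeries ℂ))) 𝓛[0, ℓv] := by
      rw [hℓv']; exact ha₁.sub ((hC _ _).mul ((toX hAalg).add (toX hgalg)))
    have hℓuc := eventually_const_of_isAlgebraic_exp hℓu (a := 𝓛[K, X₀]) bℓu ha₂
    have hℓvc := eventually_const_of_isAlgebraic_exp hℓv (a := 𝓛[K, X₀]) bℓv ha₃
    obtain ⟨δc, hδc, hcst⟩ := exists_radius_of_eventually_nhds (hℓuc.and hℓvc)
    refine Or.inr ⟨![exp (ℓu 0), exp (ℓv 0)], (hhit δc hδc).mono ?_⟩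
    rintro x ⟨hxH, ρ', hρ', hρ'δ, hpt⟩
    refine ⟨hxH, ?_⟩
    obtain ⟨hu, hv⟩ := hcst (ρ' : ℂ) (by simpa [abs_of_pos hρ'] using hρ'δ)
    funext j
    fin_cases j
    · have := congrFun hpt (Sum.inr 0)
      simp only [Sum.elim_inr, Function.comp_apply, Fin.isValue, Matrix.cons_val_zero] at this
      simpa [hu] using this
    · have := congrFun hpt (Sum.inr 1)
      simp only [Sum.elim_inr, Function.comp_apply, Fin.isValue, Matrix.cons_val_one,
        Matrix.cons_val_zero] at this
      simpa [hv] using this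
  -- ### Case 2: `ŝ ∉ cl{x̂₀}`: `L = a x₀ + b x₁` is constant on the branch
  · set L : ℂ → ℂ := fun t => (a : ℂ) * X₀ t + (b : ℂ) * X₁ t with hL
    have hLK : AnalyticAt ℂ (fun t : ℂ => t ^ K * L t) 0 :=
      analyticAt_add (analyticAt_const_mul hX₀K _) (analyticAt_const_mul hX₁K _)
    set G : LaurentSeries ℂ := HahnSeries.C (a : ℂ) * HahnSeries.single (-(e : ℤ)) (1 : ℂ) +
      HahnSeries.C (b : ℂ) * (𝓛[d + 1, fun t : ℂ => A.eval t⁻¹] + 𝓛[0, g]) with hG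
    -- `𝓛[0, a ℓu + b ℓv] = C c`
    have hsum0 : AnalyticAt ℂ (fun t : ℂ => t ^ 0 * ((a : ℂ) * ℓu t + (b : ℂ) * ℓv t)) 0 :=
      analyticAt_add (analyticAt_const_mul (h0 hℓu) _) (analyticAt_const_mul (h0 hℓv) _)
    have hsumc : 𝓛[0, fun t : ℂ => (a : ℂ) * ℓu t + (b : ℂ) * ℓv t] = HahnSeries.C c := by
      rw [← laurent_const c]
      exact laurent_congr hsum0 (h0 analyticAt_const) (eventually_nhdsWithin_of_eventually_nhds hc)
    have hsum : HahnSeries.C (a : ℂ) * 𝓛[0, ℓu] + HahnSeries.C (b : ℂ) * 𝓛[0, ℓv] = HahnSeries.C c := by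
      rw [← hsumc, laurent_add (analyticAt_const_mul (h0 hℓu) _) (analyticAt_const_mul (h0 hℓv) _),
        laurent_const_mul, laurent_const_mul]
    -- `L̂ = C c₀ G + C c`
    have hLhat : 𝓛[K, L] = HahnSeries.C (a : ℂ) * 𝓛[K, X₀] + HahnSeries.C (b : ℂ) * 𝓛[K, X₁] := by
      have h1 := laurent_add (analyticAt_const_mul hX₀K (a : ℂ)) (analyticAt_const_mul hX₁K (b : ℂ))
      beta_reduce at h1
      simp only [hL]
      rw [h1, laurent_const_mul, laurent_const_mul]
    have hLG : 𝓛[K, L] = HahnSeries.C c₀ * G + HahnSeries.C c := by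
      rw [hLhat, ← hsum, hx₀, hx₁, hG]; ring
    -- `G ∈ cl{ŝ} ∩ cl{x̂₀}`
    have hGs : IsAlgebraic (Algebra.adjoin ℂ ({𝓛[0, fun z : ℂ => z]} : Set (LaurentSeries ℂ))) G := by
      rw [hG]
      exact ((hC _ _).mul (hsingalg _ (isAlgebraic_adjoin_of_mem (Set.mem_singleton _)))).add
        ((hC _ _).mul (hAalg.add hgalg))
    have hGx : IsAlgebraic (Algebra.adjoin ℂ ({𝓛[K, X₀]} : Set (LaurentSeries ℂ))) G := by
      have hGeq : G = (𝓛[K, L] - HahnSeries.C c) * HahnSeries.C c₀⁻¹ := by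
        rw [hLG, add_sub_cancel_right, mul_comm, ← mul_assoc, ← map_mul,
          inv_mul_cancel₀ hc₀0, map_one, one_mul]
      rw [hGeq, hLhat]
      exact (((hC _ _).mul (isAlgebraic_adjoin_of_mem (Set.mem_singleton _))).add ((hC _ _).mul ha₁)).sub (hC _ _)
        |>.mul (hC _ _)
    -- hence `G` is a constant
    have hGalg : IsAlgebraic ℂ G := by
      by_contra hGt
      exact hS (isAlgebraic_adjoin_of_isAlgebraic_singleton hGx (isAlgebraic_exchange hGs hGt))
    obtain ⟨γ, hγ⟩ := mem_range_algebraMap_of_isAlgebraic hGalg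
    rw [algebraMap_laurentSeries_apply] at hγ
    -- `L` is constant on a punctured neighbourhood
    set κ : ℂ := c₀ * γ + c with hκ
    have hLκ : ∀ᶠ t in 𝓝[≠] (0 : ℂ), L t - κ = 0 := by
      have hdiff : AnalyticAt ℂ (fun t : ℂ => t ^ K * (L t - κ)) 0 := by
        have := analyticAt_add hLK (analyticAt_pow_of_le (h0 (analyticAt_const (v := -κ))) (Nat.zero_le K))
        simpa [sub_eq_add_neg] using this
      rw [← laurent_eq_zero_iff hdiff]
      have h1 := laurent_sub hLK (analyticAt_pow_of_le (h0 (analyticAt_const (v := κ))) (Nat.zero_le K))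
      beta_reduce at h1
      rw [h1, laurent_eq_of_le (h0 (analyticAt_const (v := κ))) (Nat.zero_le K), laurent_const, hLG,
        ← hγ]
      simp only [map_add, map_mul]
      ring
    obtain ⟨δc, hδc, hcst⟩ := exists_radius_of_eventually hLκ
    refine Or.inl ⟨a, b, hab, κ, (hhit δc hδc).mono ?_⟩
    rintro x ⟨hxH, ρ', hρ', hρ'δ, hpt⟩
    refine ⟨hxH, ?_⟩
    have hx0 : x 0 = X₀ ρ' := by
      have := congrFun hpt (Sum.inl 0); simpa [hX₀] using this
    have hx1 : x 1 = X₁ ρ' := by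
      have := congrFun hpt (Sum.inl 1); simpa [hX₁] using this
    have := hcst (ρ' : ℂ) (by simpa [abs_of_pos hρ'] using hρ') (by simpa [abs_of_pos hρ'] using hρ'δ)
    rw [hx0, hx1, ← sub_eq_zero]
    exact this

end Literature.NumberTheory.Transcendental

end
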